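import Summits.Ventures.Crystal3D.StickySpheres.RadiusOne
import Literature.Geometry.DiscreteGeometry.ContactNumberBounds
import HarnessLib

/-!
# Literature facts on contact numbers, transported to the cell's diameter-`1` vocabulary

HONEST FRAMING. Part of the venture `Summits/Ventures/Crystal3D` (cell `pub-crystal3d`). This file
only TRANSPORTS statements of `Literature/Geometry/DiscreteGeometry/ContactNumberBounds.lean`
(radius-`1` balls, `contactNumber` = pairs at distance `2`) through the proved scaling bridge
`StickySpheres/RadiusOne.lean` to the cell's `IsUnitPacking` / `numContacts` / `maxContacts`
(diameter-`1` balls). The Bezdek–Reid bound stays a NAMED FACT (hypothesis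
`BezdekReid2013_contactNumber_lt`, Bezdek–Reid 2013 Thm 1 (i), not proved in the tree); the fcc
octahedron with `44` balls and `168` contacts is a PROVED witness of the tree. No claim beyond
these is made.
-/

noncomputable section

namespace Summit.Ventures.Crystal3D

open Literature.Geometry.DiscreteGeometry (BezdekReid2013_contactNumber_lt fccOctahedron44
  fccOctahedron44_injective fccOctahedron44_packing_contacts)

variable {N : ℕ}

/-- **Bezdek–Reid in the cell's vocabulary** (conditional on the named fact): every packing of
`N ≥ 2` diameter-`1` balls in `ℝ³` has fewer than `6N - 0.926 N^{2/3}` contacts — the unfolded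
form of `Statement.BezdekReidBound` (= `SurfaceBound 0.926`). -/
theorem numContacts_lt_of_bezdekReid (h : BezdekReid2013_contactNumber_lt) (hN : 2 ≤ N)
    (x : Fin N → EuclideanSpace ℝ (Fin 3)) (hx : IsUnitPacking x) :
    (numContacts x : ℝ) < 6 * N - 0.926 * (N : ℝ) ^ ((2 : ℝ) / 3) := by
  obtain ⟨hinj, hP⟩ := (isUnitPacking_iff_two_smul x).1 hx
  rw [numContacts_eq_contactNumber_two_smul]
  exact h N _ hN hinj hP

/-- Hence (conditional on the named fact) `C(N) < 6N - 0.926 N^{2/3}` for the maximal contact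
number, `N ≥ 2`. -/
theorem maxContacts_lt_of_bezdekReid (h : BezdekReid2013_contactNumber_lt) (hN : 2 ≤ N) :
    (maxContacts 3 N : ℝ) < 6 * N - 0.926 * (N : ℝ) ^ ((2 : ℝ) / 3) := by
  obtain ⟨x, hx, hxe⟩ := exists_numContacts_eq_maxContacts (d := 3) (by norm_num) N
  rw [← hxe]
  exact numContacts_lt_of_bezdekReid h hN x hx

/-- **`C(44) ≥ 168`** (tree witness, Bezdek's fcc octahedron `k = 4`, transported): the
construction side `6 · 44 - ∛486 · 44^{2/3} < 168` of Bezdek 2012 Thm 1 (iii) at `N = 44` is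
`bezdek2012_fcc_lower_bound_k4` in the Literature file. -/
theorem le_maxContacts_fortyFour : 168 ≤ maxContacts 3 44 :=
  le_maxContacts_of_radiusOne fccOctahedron44_injective fccOctahedron44_packing_contacts.1
    fccOctahedron44_packing_contacts.2

end Summit.Ventures.Crystal3D

end
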